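import Literature.AnabelianGeometry.AbsoluteAnabelian.MLFGaloisGroups
import Literature.AnabelianGeometry.AbsoluteAnabelian.AbsTopIII.KummerFaithful
import Mathlib.FieldTheory.Galois.Infinite
import Mathlib.RingTheory.Norm.Basic
import HarnessLib

/-!
# Slimness of `G_K` for torally Kummer-faithful fields with a discrete valuation
# (the engine behind [AbsAnab] Thm 1.1.1 (ii), reciprocity-free)

S. Mochizuki, *The Absolute Anabelian Geometry of Hyperbolic Curves* (2004) [AbsAnab], Thm 1.1.1
(ii) p. 6 ("`G_F`, `G_𝔭` are slim"; the form [IUTchI] cites), and *Topics in Absolute Anabelian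
Geometry III*, Def. 1.5 / Rmk. 1.5.4 (torally Kummer-faithful fields).  This proof-only file
isolates the GENERAL THEOREM behind the unconditional proofs of `galoisMLF_slim` /
`galoisNF_slim` (files `MLFSlimKummerProofs`, `NFSlimKummerProofs`), universe-polymorphically:

`isSlimGroup_absoluteGaloisGroup_of_isTorallyKummerFaithful` : if `K` is torally Kummer-faithful
(`⋂_N (M^×)^N = 1` for every finite `M/K`) and admits a homomorphism `v : K^× → ℤ` that does not
vanish identically (e.g. any discrete valuation), then `G_K = Gal(K̄/K)` is slim.

Proof (Kummer theory + the norm): let `σ` centralise `Gal(K̄/E₀)` (`E₀/K` finite) and `x ∈ K̄`;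
`M := E₀(x)`.  (1) `exists_int_forall_sigma_eq`: for `n ≥ 1`, with `σ ζ = ζ^m` on `μ_n(K̄)`,
every `a ∈ M^×` satisfies `σ(a) = βⁿ a^m` with `β ∈ M^×` (`β := σ(α)/α^m`, `αⁿ = a`, is fixed by
`Gal(K̄/M)`).  (2) For `a = a₀ ∈ K^×` with `v(a₀) ≠ 0` this reads `βⁿ = a₀^{1−m}`; applying the
norm `N_{M/K}` and then `v` gives `n·v(Nβ) = [M:K]·(1−m)·v(a₀)`, so for `n = N·[M:K]·|v(a₀)|`
one gets `N ∣ m − 1`.  (3) Hence `σ(x)/x ∈ (M^×)^N` for every `N`, i.e. `σ(x) = x` by toral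
Kummer-faithfulness.  No class field theory, no [NSW] 12.1.3.

Corollaries elsewhere: MLF's (`MLFSlimKummerProofs`), number fields (`NFSlimKummerProofs`); the
theorem is stated here for reuse (function fields over such fields, sub-`p`-adic fields).
Proof-only: no definitions. [cite: MochizukiAbsAnab2004, Thm 1.1.1 (ii) p.6]
-/

noncomputable section

open scoped Classical IntermediateField

namespace Literature.AnabelianGeometry.AbsoluteAnabelian

open Field IntermediateField
open Literature.AlgebraicGeometry.Frobenioids (IsSlimGroup)
open AbsTopIII

universe u

section General

variable {K : Type u} [Field K] [CharZero K]

/-- Infinite Galois theory for `K̄/K` (`char K = 0`), universe-polymorphic form of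
`exists_intermediateField_of_isOpen_absoluteGaloisGroup`: an open subgroup of `Gal(K̄/K)` is
`Gal(K̄/E)` for a finite subextension `E`. [cite: MochizukiAbsAnab2004, Lemma 1.1.4 proof p.7] -/
private theorem exists_intermediateField_of_isOpen' (N : Subgroup (absoluteGaloisGroup K))
    (hN : IsOpen (N : Set (absoluteGaloisGroup K))) :
    ∃ E : IntermediateField K (AlgebraicClosure K), FiniteDimensional K E ∧
      E.fixingSubgroup.comap (absoluteGaloisGroup.toAlgEquiv K).toMonoidHom = N := by
  have hc : IsClosed (N : Set (absoluteGaloisGroup K)) := N.isClosed_of_isOpen hN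
  let N' : ClosedSubgroup (AlgebraicClosure K ≃ₐ[K] AlgebraicClosure K) :=
    ⟨(N : Subgroup (AlgebraicClosure K ≃ₐ[K] AlgebraicClosure K)), hc⟩
  have hfix : (IntermediateField.fixedField N'.1).fixingSubgroup = N'.1 :=
    InfiniteGalois.fixingSubgroup_fixedField N'
  refine ⟨IntermediateField.fixedField N'.1, ?_, ?_⟩
  · rw [← InfiniteGalois.isOpen_iff_finite, hfix]
    exact hN
  · rw [hfix]
    ext σ
    exact Iff.rfl

/-- KUMMER STEP (universe-polymorphic form of `exists_int_forall_sigma_eq`): for `σ ∈ Gal(K̄/K)`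
commuting with `Gal(K̄/M)` and `n ≥ 1`, there is `m ∈ ℤ` with `σ(a) = βⁿ · a^m`, `β ∈ M^×`, for all
`a ∈ M^×`. [cite: MochizukiAbsAnab2004, Thm 1.1.1 (ii) p.6] -/
private theorem exists_int_forall_sigma_eq' (M : IntermediateField K (AlgebraicClosure K))
    (σ : AlgebraicClosure K ≃ₐ[K] AlgebraicClosure K)
    (hσ : ∀ τ ∈ M.fixingSubgroup, ∀ y : AlgebraicClosure K, τ (σ y) = σ (τ y))
    {n : ℕ} (hn : 0 < n) :
    ∃ m : ℤ, ∀ a : AlgebraicClosure K, a ∈ M → a ≠ 0 →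
      ∃ β : AlgebraicClosure K, β ∈ M ∧ β ≠ 0 ∧ σ a = β ^ n * a ^ m := by
  haveI : NeZero n := ⟨hn.ne'⟩
  obtain ⟨m, hm⟩ := rootsOfUnity.integer_power_of_ringEquiv n (σ : AlgebraicClosure K ≃+* _)
  refine ⟨m, fun a haM ha0 => ?_⟩
  obtain ⟨α, hα⟩ := IsAlgClosed.exists_pow_nat_eq a hn
  have hα0 : α ≠ 0 := by
    rintro rfl
    rw [zero_pow hn.ne'] at hα
    exact ha0 hα.symm
  set β : AlgebraicClosure K := σ α / α ^ m with hβdef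
  have hβ0 : β ≠ 0 := by
    rw [hβdef]
    exact div_ne_zero ((map_ne_zero σ).mpr hα0) (zpow_ne_zero _ hα0)
  have hβM : β ∈ M := by
    rw [← InfiniteGalois.fixedField_fixingSubgroup M, IntermediateField.mem_fixedField_iff]
    intro τ hτ
    have hτa : τ a = a := (IntermediateField.mem_fixingSubgroup_iff _ _).mp hτ a haM
    have hζn : (τ α / α) ^ n = 1 := by
      rw [div_pow, ← map_pow, hα, hτa, div_self ha0]
    have hζ0 : τ α / α ≠ 0 := div_ne_zero ((map_ne_zero τ).mpr hα0) hα0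
    set ζu : (AlgebraicClosure K)ˣ := Units.mk0 (τ α / α) hζ0 with hζu
    have hζmem : ζu ∈ rootsOfUnity n (AlgebraicClosure K) := by
      rw [mem_rootsOfUnity]
      exact Units.ext (by simp [hζu, hζn])
    have hσζ : σ (τ α / α) = (τ α / α) ^ m := by
      have := hm ⟨ζu, hζmem⟩
      simpa [hζu, Units.val_zpow_eq_zpow_val] using this
    have hτα : τ α = (τ α / α) * α := by rw [div_mul_cancel₀ _ hα0]
    rw [hβdef, map_div₀, map_zpow₀, hσ τ hτ α, hτα, map_mul, hσζ, mul_zpow]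
    field_simp
  refine ⟨β, hβM, hβ0, ?_⟩
  have hσα : σ α = β * α ^ m := by rw [hβdef, div_mul_cancel₀ _ (zpow_ne_zero _ hα0)]
  calc σ a = σ (α ^ n) := by rw [hα]
    _ = (β * α ^ m) ^ n := by rw [map_pow, hσα]
    _ = β ^ n * (α ^ n) ^ m := by rw [mul_pow, ← zpow_natCast (α ^ m), ← zpow_mul, mul_comm m,
        zpow_mul, zpow_natCast]
    _ = β ^ n * a ^ m := by rw [hα]

end General

/-- **Slimness from toral Kummer-faithfulness and a discrete valuation** ([AbsAnab] Thm 1.1.1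
(ii), the mechanism made general): if `K` is torally Kummer-faithful and `v : K^× → ℤ` is a
homomorphism with `v(a₀) ≠ 0` for some `a₀`, then the absolute Galois group `Gal(K̄/K)` is slim.
[cite: MochizukiAbsAnab2004, Thm 1.1.1 (ii) p.6] -/
theorem isSlimGroup_absoluteGaloisGroup_of_isTorallyKummerFaithful {K : Type u} [Field K]
    (hK : IsTorallyKummerFaithful K) (v : Kˣ →* Multiplicative ℤ) (a₀ : Kˣ) (ha₀ : v a₀ ≠ 1) :
    IsSlimGroup (absoluteGaloisGroup K) := by
  haveI : CharZero K := hK.charZero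
  haveI : Algebra.IsAlgebraic K (AlgebraicClosure K) := AlgebraicClosure.isAlgebraic K
  -- the additive valuation
  let ν : Kˣ → ℤ := fun y => Multiplicative.toAdd (v y)
  have hνmul : ∀ y z : Kˣ, ν (y * z) = ν y + ν z := fun y z => by
    simp only [ν, map_mul, toAdd_mul]
  have hνpow : ∀ (y : Kˣ) (k : ℕ), ν (y ^ k) = k * ν y := fun y k => by
    simp only [ν, map_pow, toAdd_pow, nsmul_eq_mul]
  have hνzpow : ∀ (y : Kˣ) (k : ℤ), ν (y ^ k) = k * ν y := fun y k => by
    simp only [ν, map_zpow, toAdd_zpow, zsmul_eq_mul, Int.cast_id]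
  have hνa₀ : ν a₀ ≠ 0 := by
    intro h
    apply ha₀
    simpa [ν] using congrArg Multiplicative.ofAdd h
  set c : ℕ := (ν a₀).natAbs with hcdef
  have hc : 0 < c := Int.natAbs_pos.mpr hνa₀
  refine ⟨fun U hU => ?_⟩
  rw [eq_bot_iff]
  intro σ hσ
  rw [Subgroup.mem_centralizer_iff] at hσ
  rw [Subgroup.mem_bot]
  set σ' : AlgebraicClosure K ≃ₐ[K] AlgebraicClosure K :=
    absoluteGaloisGroup.toAlgEquiv K σ with hσ'
  suffices hfix : ∀ x : AlgebraicClosure K, σ' x = x by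
    apply (absoluteGaloisGroup.toAlgEquiv K).injective
    rw [map_one]
    exact AlgEquiv.ext hfix
  obtain ⟨E₀, hE₀fin, hE₀U⟩ := exists_intermediateField_of_isOpen' U hU
  haveI := hE₀fin
  intro x
  by_cases hx0 : x = 0
  · rw [hx0, map_zero]
  haveI : FiniteDimensional K K⟮x⟯ :=
    IntermediateField.adjoin.finiteDimensional (Algebra.IsIntegral.isIntegral x)
  set M : IntermediateField K (AlgebraicClosure K) := E₀ ⊔ K⟮x⟯ with hMdef
  haveI : FiniteDimensional K M := IntermediateField.finiteDimensional_sup E₀ K⟮x⟯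
  have hxM : x ∈ M := (le_sup_right : K⟮x⟯ ≤ M) (IntermediateField.mem_adjoin_simple_self K x)
  have hcomm : ∀ τ ∈ M.fixingSubgroup, ∀ y : AlgebraicClosure K, τ (σ' y) = σ' (τ y) := by
    intro τ hτ y
    have hτE₀ : τ ∈ E₀.fixingSubgroup := by
      rw [IntermediateField.mem_fixingSubgroup_iff] at hτ ⊢
      exact fun z hz => hτ z ((le_sup_left : E₀ ≤ M) hz)
    have hτU : (absoluteGaloisGroup.toAlgEquiv K).symm τ ∈ U := by
      rw [← hE₀U]
      exact hτE₀
    have h := hσ _ hτU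
    have h' := congrArg (fun g => absoluteGaloisGroup.toAlgEquiv K g y) h
    simpa [hσ', AlgEquiv.mul_apply] using h'
  have hσxM : σ' x ∈ M := by
    rw [← InfiniteGalois.fixedField_fixingSubgroup M, IntermediateField.mem_fixedField_iff]
    intro τ hτ
    rw [hcomm τ hτ x, (IntermediateField.mem_fixingSubgroup_iff _ _).mp hτ x hxM]
  -- the degree `d = [M : K]`
  set d : ℕ := Module.finrank K M with hddef
  have hd : 0 < d := Module.finrank_pos
  -- the unit `u := σ x / x` of `M`
  have hσx0 : σ' x ≠ 0 := (map_ne_zero σ').mpr hx0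
  set xM : M := ⟨x, hxM⟩ with hxMdef
  set sxM : M := ⟨σ' x, hσxM⟩ with hsxMdef
  have hxM0 : xM ≠ 0 := fun h => hx0 (congrArg Subtype.val h)
  have hsxM0 : sxM ≠ 0 := fun h => hσx0 (congrArg Subtype.val h)
  set u : Mˣ := Units.mk0 sxM hsxM0 / Units.mk0 xM hxM0 with hudef
  have hdiv : ∀ N : ℕ, 0 < N → ∃ b : Mˣ, b ^ N = u := by
    intro N hN
    have hn : 0 < N * (d * c) := Nat.mul_pos hN (Nat.mul_pos hd hc)
    obtain ⟨m, hm⟩ := exists_int_forall_sigma_eq' M σ' hcomm hn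
    -- Step (2): `a₀ ∈ K` is fixed by `σ`, which pins down `m` modulo `N`
    set aΩ : AlgebraicClosure K := algebraMap K (AlgebraicClosure K) (a₀ : K) with haΩdef
    have haΩM : aΩ ∈ M := M.algebraMap_mem _
    have haΩ0 : aΩ ≠ 0 := by
      rw [haΩdef, map_ne_zero]
      exact a₀.ne_zero
    obtain ⟨β, hβM, hβ0, hσa⟩ := hm aΩ haΩM haΩ0
    rw [haΩdef, AlgEquiv.commutes] at hσa
    -- as units of `M`: `aU = βU ^ n * aU ^ m`
    set aM : M := algebraMap K M (a₀ : K) with haMdef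
    have haM0 : aM ≠ 0 := by
      rw [haMdef, map_ne_zero]
      exact a₀.ne_zero
    set βM : M := ⟨β, hβM⟩ with hβMdef
    have hβM0 : βM ≠ 0 := fun h => hβ0 (congrArg Subtype.val h)
    set aU : Mˣ := Units.mk0 aM haM0 with haUdef
    set βU : Mˣ := Units.mk0 βM hβM0 with hβUdef
    have hUeq : aU = βU ^ (N * (d * c)) * aU ^ m := by
      apply Units.ext
      apply (algebraMap M (AlgebraicClosure K)).injective
      rw [Units.val_mul, Units.val_pow_eq_pow_val, Units.val_zpow_eq_zpow_val, map_mul, map_pow,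
        map_zpow₀]
      exact hσa
    -- apply the norm `N_{M/K}` (on units) and then `ν`
    set NU : Mˣ →* Kˣ := Units.map (Algebra.norm K : M →* K) with hNUdef
    have hNa : NU aU = a₀ ^ d := by
      apply Units.ext
      rw [hNUdef, Units.coe_map, haUdef, Units.val_mk0, haMdef, Units.val_pow_eq_pow_val]
      exact Algebra.norm_algebraMap (a₀ : K)
    have hNeq : a₀ ^ d = NU βU ^ (N * (d * c)) * (a₀ ^ d) ^ m := by
      rw [← hNa, ← map_pow, ← map_zpow, ← map_mul, ← hUeq]
    have hνeq : (d : ℤ) * ν a₀ = (N * (d * c) : ℕ) * ν (NU βU) + m * ((d : ℤ) * ν a₀) := by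
      have := congrArg ν hNeq
      rw [hνmul, hνpow, hνzpow, hνpow, hνpow] at this
      exact_mod_cast this
    -- solve for `m`: `m = 1 + N * t`
    have hm1 : ∃ t : ℤ, m = 1 + N * t := by
      have hsc : ν a₀ = c ∨ ν a₀ = -c := by
        rcases Int.natAbs_eq (ν a₀) with h | h
        · left; rw [← hcdef] at h; exact h
        · right; rw [← hcdef] at h; exact h
      have hd0 : (d : ℤ) ≠ 0 := by exact_mod_cast hd.ne'
      have hc0 : (c : ℤ) ≠ 0 := by exact_mod_cast hc.ne'
      push_cast at hνeq
      rcases hsc with h | h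
      · refine ⟨-ν (NU βU), ?_⟩
        rw [h] at hνeq
        have : (d : ℤ) * c * (1 - m - N * ν (NU βU)) = 0 := by linear_combination hνeq
        rcases mul_eq_zero.mp this with h1 | h1
        · exact absurd h1 (mul_ne_zero hd0 hc0)
        · linarith
      · refine ⟨ν (NU βU), ?_⟩
        rw [h] at hνeq
        have : (d : ℤ) * c * (m - 1 - N * ν (NU βU)) = 0 := by linear_combination hνeq
        rcases mul_eq_zero.mp this with h1 | h1
        · exact absurd h1 (mul_ne_zero hd0 hc0)
        · linarith
    obtain ⟨t, ht⟩ := hm1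
    -- Step (1) for `a = x`
    obtain ⟨β', hβ'M, hβ'0, hσxeq⟩ := hm x hxM hx0
    have hb0 : (⟨β' ^ (d * c) * x ^ t, mul_mem (pow_mem hβ'M _) (zpow_mem hxM t)⟩ : M) ≠ 0 := by
      intro h
      have := congrArg Subtype.val h
      exact mul_ne_zero (pow_ne_zero _ hβ'0) (zpow_ne_zero _ hx0) this
    refine ⟨Units.mk0 _ hb0, ?_⟩
    apply Units.ext
    apply Subtype.ext
    change (β' ^ (d * c) * x ^ t) ^ N = σ' x / x
    rw [hσxeq, ht, eq_div_iff hx0, mul_pow, ← pow_mul, mul_comm (d * c) N, ← zpow_natCast (x ^ t),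
      ← zpow_mul]
    rw [show x ^ (1 + (N : ℤ) * t) = x * x ^ (t * (N : ℤ)) by
      rw [← zpow_one_add₀ hx0]; ring_nf]
    ring
  have hu1 : u = 1 := (hK.units M inferInstance).eq_one_of_forall_exists_pow u hdiv
  have := congrArg (fun w : Mˣ => ((w : M) : AlgebraicClosure K)) hu1
  simp only [hudef, Units.val_div_eq_div_val, Units.val_mk0, Units.val_one] at this
  have hval : ((sxM / xM : M) : AlgebraicClosure K) = σ' x / x := rfl
  rw [hval] at this
  simpa [div_eq_one_iff_eq hx0] using this

/-- Center-freeness from slimness: under the same hypotheses `Gal(K̄/K)` has trivial centre.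
[cite: MochizukiAbsAnab2004, Thm 1.1.1 (ii) p.6] -/
theorem center_absoluteGaloisGroup_eq_bot_of_isTorallyKummerFaithful {K : Type u} [Field K]
    (hK : IsTorallyKummerFaithful K) (v : Kˣ →* Multiplicative ℤ) (a₀ : Kˣ) (ha₀ : v a₀ ≠ 1) :
    Subgroup.center (absoluteGaloisGroup K) = ⊥ := by
  have h := (isSlimGroup_absoluteGaloisGroup_of_isTorallyKummerFaithful hK v a₀ ha₀).centralizer_eq_bot
    ⊤ isOpen_univ
  rw [eq_bot_iff] at h ⊢
  intro z hz
  refine h ?_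
  rw [Subgroup.mem_centralizer_iff]
  intro g _
  exact ((Subgroup.mem_center_iff.mp hz) g)

end Literature.AnabelianGeometry.AbsoluteAnabelian
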